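/-
Copyright (c) 2026 the pub-hodgecm-mathlib formalisation cell (harness21).  Prover seat hodgecm-mathlib-K2E1-p14 (g0), Track B «K2-LIT» ENGINE E1, h413 =
`stmt-HodgeConjecture-24833`, route `HCCMUnconditional`, campaign «5Res» (b) «BL-2(χ,τ)» — (χ,τ)-EXPORTS X2_χ core, dealt by K2E1-plan (g6) (125) ∕ (g7) (148) «X2_χ core "="»;
REPORT-FIRST R3 on the K2 bus (census 11:41:18Z, heads with this file).
-/
import Summits.HodgeConjecture.HodgeConjecture.Theorems.K2E1ChiEisensteinMeromorphicU2                     -- ★ p859710 row 13 (K2E1-p15 g0): `chiEisenstein_meromorphic_globalPoleSet_of_balls`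
import Summits.HodgeConjecture.HodgeConjecture.Theorems.K2E1SphericalEisensteinMeromorphicExportsU2Global  -- ★ p859664 X2 core (the spherical template): brings ★ P3-D `exists_evalCLM`, ★ X2a `continuous_integral_mul_lift`, ★ `quotFun_lift`
import HarnessLib

/-!
# h413 ∕ Track B «K2-LIT», 5Res (b) «BL-2(χ,τ)» — `K2E1ChiEisensteinMeromorphicExportsU2Global`, (χ,τ)-EXPORTS X2_χ CORE (hypothesis-first on the per-ball packages): ONE COMMON
# POLE SET for the glued `χ`-Eisenstein family and its coefficient pieces, (E1) analyticity off it, (E5) the POINTWISE REPRESENTATION `Ec z g = ĥ_j(z)⁻¹·∫ h_j(y)·vX_n(z)[(g y)⁻¹] dν_G`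
# on `U n ∖ P`, and (E4) CONTINUITY of `g ↦ Ec z g` off `P` — plus the coefficient PATCH lemma feeding X1_χ ED. 2's meromorphic parameter into the gluing

Cell `pub/hodgecm-mathlib`, crux H413 = `stmt-HodgeConjecture-24833`; dealer K2E1-plan (g7).  THEOREMS ONLY (no `def`, no `instance`, no `notation`, no named-fact hypothesis, no `sorry`);
lane `--kind proof --supports stmt-HodgeConjecture-24833 --as helper` (count-neutral).  §1 generic; §2 the CM pair `(L⁺, L, conj)`, `N = 2`, for a continuous bounded section `φ`
(every `φ ∈ chiSectionSpace χ K′ ω` of rows 2–4∕9).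

THE MATHEMATICS [BernsteinLapid2019, Thm 2.3, §2.1, §2.4, §4 Claims 1–5 and p. 10; MoeglinWaldspurger1995, IV.1.8–IV.1.10].  ★ X2 core
`K2E1SphericalEisensteinMeromorphicExportsU2Global.sphericalEisenstein_meromorphic_exports_core_cm_two` glues ★ X1's CM per-ball packages of the SPHERICAL series with ONE call of ★
`exists_global_pole_set` and derives (E1) (analyticity off the common pole set `P`), (E3) (the coefficient), (E4) (continuity in `g` off `P`) and (E5) (the pointwise representation of the
glued `Ec` through the vector solution `vX_n` and the ★ P3-D evaluation functionals).  For a `(χ,τ)`-section the per-ball package is X1_χ (★ p859822 `exists_chi_xSystem_byproducts[']`,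
letters hypothesis-first; its CM assembly waits for the (χ,τ) convData) and the scalar gluing with a common pole set is ★ row 13 `chiEisenstein_meromorphic_globalPoleSet_of_balls` (index
`G(𝔸) ⊕ J`, coefficient pieces as scalar families `Fq j n`).  THIS FILE adds, HYPOTHESIS-FIRST ON THE PER-BALL PACKAGES (the standing «binders, not waiting» rule): §1 the PATCH LEMMA
**`meromorphicOn_patch_of_coDiscrete`** — a piece `cc` meromorphic on the ball, holomorphic on a co-discrete `U` and equal to the Godement-range function `q` on `U ∩ {σ₀ < Re}`, patched
to `q` on `{σ₀ < Re}`, is meromorphic on the ball, `= q` on its Godement part, of non-negative order on `U`, and has the same punctured germs as `cc` (★ X2 core :hpatch∕hF′∕hord′ made a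
lemma; it turns X1_χ ED. 2's `MeromorphicOn cc (ball)` + `cc = bX on U ∩ O` into row 13's `hFq hFqq hFqord`, coordinate by coordinate); §2 HEAD **`chiEisenstein_meromorphic_exports_core_of_packages`**
= ★ row 13's conclusion VERBATIM (glued `Ec`, `qc`, ONE closed co-discrete `P ⊆ {Re ≤ 1}`, NF-meromorphy, Godement agreement, NF-germ agreement with the pieces, (E1)) PLUS **(E5)** at every
`z ∈ U n ∖ P` (`n ≥ n₀`) with `ĥ_{n,j}(z) ≠ 0`: `Ec z g = ĥ_{n,j}(z)⁻¹ · ∫ h_{n,j}(y)·vX_n(z)[(g y)⁻¹] dν_G(y)` (NF-germ equality AT `z`: the glued function is analytic at `z ∉ P`, the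
right side — the ★ P3-D functional `Λ_{g,j}` of the real test function `h_{n,j}` applied to `vX_n`, ★ `quotFun_lift` — is continuous at `z` because `vX_n` is holomorphic on `U n`; limits
along `𝓝[≠] z` agree) PLUS **(E4)** `g ↦ Ec z g` CONTINUOUS for every `z ∉ P` (on `{1 < Re}` it is `E(f_z^φ)`, ★ `continuous_eisensteinSeriesU_flatSectionU_cm_two` for bounded continuous
`φ`; elsewhere (E5) at the ball `max n₀ ⌈‖z‖⌉₊` + ★ X2a `continuous_integral_mul_lift`).  The per-ball INPUTS are exactly X1_χ §1's OUTPUT clauses (`U n` open ⊆ ball co-discrete,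
`vX n` holomorphic on `U n`, the scalar pieces `F g n` meromorphic ∕ Godement-agreeing ∕ of non-negative order on `U n` ∕ with germs IN INTEGRAL FORM through the real test functions
`h n j`) and row 13's coefficient-piece clauses; the CM assembly of X1_χ (ED. 3) discharges them, as ★ X1 does for `χ = 1`.
HONEST LABEL: HC_CM is proved only modulo the 7 printed citations (2 remaining named inputs: hLiu418 = `stmt-HodgeConjecture-24832`, h413 = `stmt-HodgeConjecture-24833`) until rung 0
closes; this file asserts no named fact, closes no socket; count-neutral.  NOT claimed: (E3)_χ (the constant-term link with the operator `M(z,χ)` — row 2∕3 + `hLinj`), (E2) bounds, location of poles.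

## References
* [BernsteinLapid2019] J. Bernstein, E. Lapid, *On the meromorphic continuation of Eisenstein series*, J. Amer. Math. Soc. 37 (2024) (arXiv:1911.02342), Thm 2.3, §2.1, §2.4, §4 Claims 1–5, p. 10.
* [MoeglinWaldspurger1995] C. Mœglin, J.-L. Waldspurger, *Spectral Decomposition and Eisenstein Series* (1995), II.1.5, IV.1.8–IV.1.10.
* [ReedSimonI1980] M. Reed, B. Simon, *Methods of Modern Mathematical Physics I* (1980), Thm. VI.14.
-/

set_option autoImplicit false
-- the mandated namespace repeats `HodgeConjecture.HodgeConjecture`, as in every `Theorems/*.lean` of this sub-problem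
set_option linter.dupNamespace false

noncomputable section

open MeasureTheory Filter Topology Set NumberField
open scoped NNReal ENNReal Classical ComplexConjugate
open Literature.MeasureTheory.Group Literature.NumberTheory Literature.NumberTheory.Automorphic Literature.NumberTheory.Automorphic.UnitaryGroup AdelicGroupData
open Summit.HodgeConjecture.HodgeConjecture.Cruxes.H413.K2E1BorelEisensteinU
open Summit.HodgeConjecture.HodgeConjecture.Cruxes.H413.K2E1BLBorelSpacesU2Defs
open Summit.HodgeConjecture.HodgeConjecture.Cruxes.H413.K2E1BLBorelOperatorsU2Defs
open Summit.HodgeConjecture.HodgeConjecture.Cruxes.H413.K2E1BLEvaluationFunctionalU2 (exists_evalCLM)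
open Summit.HodgeConjecture.HodgeConjecture.Cruxes.H413.K2E1BLLiftIntegrabilityU (quotFun_lift lift_quotientSubgroup_mul)
open Summit.HodgeConjecture.HodgeConjecture.Cruxes.H413.K2E1BorelEisensteinRegularU (continuous_eisensteinSeriesU_flatSectionU_cm_two)
open Summit.HodgeConjecture.HodgeConjecture.Cruxes.H413.K2E1SphericalHeckeEigenSectionU2 (differentiable_integral_mul_borelHeight_cpow)
open Summit.HodgeConjecture.HodgeConjecture.Cruxes.H413.K2E1SphericalEisensteinCoefficientCMTwo (continuous_integral_mul_lift)
open Summit.HodgeConjecture.HodgeConjecture.Cruxes.H413.K2E1ChiEisensteinMeromorphicU2 (chiEisenstein_meromorphic_globalPoleSet_of_balls)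

namespace Summit.HodgeConjecture.HodgeConjecture.Cruxes.H413.K2E1ChiEisensteinMeromorphicExportsU2Global

/-! ## §1 The coefficient patch (generic): a piece meromorphic on `D`, holomorphic on a co-discrete `U`, equal to `q` on `U ∩ {σ₀ < Re}`, patched to `q` on `{σ₀ < Re}` -/

/-- **THE COEFFICIENT PATCH** (★ X2 core's `hpatch`∕`hF′`∕`hord′` as a lemma, values in any normed space): if `cc` is meromorphic on `D`, holomorphic on an open `U` which is CO-DISCRETE in
`D`, and `cc = q` on `U ∩ {σ₀ < Re}`, then the patched function `s ↦ if σ₀ < Re s then q s else cc s` has the same punctured germs as `cc` at every point of `D`, hence is meromorphic on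
`D`, of NON-NEGATIVE ORDER at every point of `U ∩ D`, and equals `q` on `D ∩ {σ₀ < Re}` — the shape of ★ row 13's `hFq`, `hFqq`, `hFqord` for the coefficient pieces (coordinates of
X1_χ ED. 2's parameter `cc : ℂ → B`). [cite: BernsteinLapid2019, §2.1 and §4 p. 10] -/
theorem meromorphicOn_patch_of_coDiscrete {𝓥 : Type*} [NormedAddCommGroup 𝓥] [NormedSpace ℂ 𝓥] [CompleteSpace 𝓥] {D U : Set ℂ} (hUo : IsOpen U)
    (hUcd : ∀ z₀ ∈ D, ∀ᶠ s in 𝓝[≠] z₀, s ∈ U) {σ₀ : ℝ} {cc q : ℂ → 𝓥} (hccd : DifferentiableOn ℂ cc U) (hccm : MeromorphicOn cc D)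
    (hagree : ∀ z ∈ U, σ₀ < z.re → cc z = q z) :
    (∀ z ∈ D, cc =ᶠ[𝓝[≠] z] fun s => if σ₀ < s.re then q s else cc s) ∧
      MeromorphicOn (fun s => if σ₀ < s.re then q s else cc s) D ∧
      (∀ z ∈ D, σ₀ < z.re → (fun s => if σ₀ < s.re then q s else cc s) z = q z) ∧
      ∀ z ∈ D, z ∈ U → 0 ≤ meromorphicOrderAt (fun s => if σ₀ < s.re then q s else cc s) z := by
  have hpatch : ∀ z ∈ D, cc =ᶠ[𝓝[≠] z] fun s => if σ₀ < s.re then q s else cc s := fun z hz => by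
    filter_upwards [hUcd z hz] with s hs
    by_cases h1 : σ₀ < s.re
    · rw [if_pos h1]; exact hagree s hs h1
    · rw [if_neg h1]
  refine ⟨hpatch, fun z hz => (hccm z hz).congr (hpatch z hz), fun z _ hz1 => by simp only [if_pos hz1], fun z hz hzU => ?_⟩
  rw [← meromorphicOrderAt_congr (hpatch z hz)]
  exact (hccd.analyticAt (hUo.mem_nhds hzU)).meromorphicOrderAt_nonneg

/-! ## §2 The CM pair: X2_χ core, hypothesis-first on the per-ball packages of X1_χ -/

section CM

variable (L : Type) [Field L] [NumberField L] [IsCMField L]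
  [MeasurableSpace (quasiSplit (↥(maximalRealSubfield L)) L (IsCMField.complexConj L) 2).Adelic] [BorelSpace (quasiSplit (↥(maximalRealSubfield L)) L (IsCMField.complexConj L) 2).Adelic]

/-- **X2_χ CORE — THE GLOBAL BERNSTEIN–LAPID EXPORTS OF A `χ`-EISENSTEIN FAMILY OF `U(1,1)_{L∕L⁺}`, HYPOTHESIS-FIRST ON THE PER-BALL PACKAGES.**  Data: the measures `μ` (automorphic),
`ν_G` (Haar, inversion-invariant); a continuous bounded section `φ`; `n₀`; per ball `D_n = ball 0 (n+2)`, `n ≥ n₀`: real test functions `h n j` (continuous, compactly supported,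
`conj h = h`) whose height transforms `ĥ_{n,j}` have no common zero on `D_n`; the co-discrete open holomorphy set `U n ⊆ D_n`; the vector solution `vX n : ℂ → 𝓗_{k n}(𝔛)` holomorphic on
`U n`; the scalar pieces `F g n`, meromorphic on `D_n`, `= E(f_z^φ)(g)` on its Godement part, of non-negative order on `U n`, with GERMS IN INTEGRAL FORM
`F g n =ᶠ[𝓝[≠] z] s ↦ ĥ_{n,j}(s)⁻¹·∫ h_{n,j}(y)·vX_n(s)[(g y)⁻¹] dν_G` at every `z ∈ U n` with `ĥ_{n,j}(z) ≠ 0` (X1_χ §1's (R4)-clause at the ★ P3-D functionals); and scalar coefficient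
pieces `Fq j n` against Godement-range functions `q j` exactly as ★ row 13.  THEN: ★ row 13's conclusion VERBATIM (`Ec`, `qc`, ONE common pole set `P`) AND (E5) the pointwise
representation of `Ec z g` on `U n ∖ P` AND (E4) the continuity of `g ↦ Ec z g` for every `z ∉ P` — the (χ,τ) print of ★ X2 core :hE5∕:hE4.
[cite: BernsteinLapid2019, Thm 2.3, §2.1, §2.4 and §4 Claims 1–5 (pp. 9–10)] [cite: MoeglinWaldspurger1995, IV.1.8–IV.1.10] -/
theorem chiEisenstein_meromorphic_exports_core_of_packages
    (μ : Measure (quasiSplit (↥(maximalRealSubfield L)) L (IsCMField.complexConj L) 2).automorphicQuotient) [(quasiSplit (↥(maximalRealSubfield L)) L (IsCMField.complexConj L) 2).IsAutomorphicMeasure μ]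
    (νG : Measure (quasiSplit (↥(maximalRealSubfield L)) L (IsCMField.complexConj L) 2).Adelic) [νG.IsHaarMeasure] [νG.IsInvInvariant] [SFinite νG]
    {φ : (quasiSplit (↥(maximalRealSubfield L)) L (IsCMField.complexConj L) 2).Adelic → ℂ} (hφc : Continuous φ) {M : ℝ} (hφM : ∀ x, ‖φ x‖ ≤ M) (n₀ : ℕ) (k : ℕ → ℕ)
    -- per ball: the real test functions and the cover of the ball by their height transforms
    {I : ℕ → Type} (h : (n : ℕ) → I n → (quasiSplit (↥(maximalRealSubfield L)) L (IsCMField.complexConj L) 2).Adelic → ℂ) (hhc : ∀ n i, Continuous (h n i)) (hhs : ∀ n i, HasCompactSupport (h n i))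
    (hreal : ∀ n i x, conj (h n i x) = h n i x)
    (hcov : ∀ n : ℕ, n₀ ≤ n → ∀ z ∈ Metric.ball (0 : ℂ) (n + 2), ∃ i, (∫ x, h n i x * (((borelHeight x : ℝ≥0) : ℝ) : ℂ) ^ z ∂νG) ≠ 0)
    -- per ball: the co-discrete open holomorphy set and the vector solution, holomorphic there
    {U : ℕ → Set ℂ} (hUo : ∀ n : ℕ, n₀ ≤ n → IsOpen (U n)) (hUD : ∀ n : ℕ, n₀ ≤ n → U n ⊆ Metric.ball (0 : ℂ) (n + 2))
    (hUcd : ∀ n : ℕ, n₀ ≤ n → ∀ z₀ ∈ Metric.ball (0 : ℂ) (n + 2), ∀ᶠ s in 𝓝[≠] z₀, s ∈ U n)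
    (vX : (n : ℕ) → ℂ → HX (↥(maximalRealSubfield L)) L (IsCMField.complexConj L) 2 (k n) μ) (hvXd : ∀ n : ℕ, n₀ ≤ n → DifferentiableOn ℂ (vX n) (U n))
    -- per ball: the scalar pieces of the Eisenstein family (meromorphic, Godement agreement, order ≥ 0 on `U n`, germs in integral form)
    {F : (quasiSplit (↥(maximalRealSubfield L)) L (IsCMField.complexConj L) 2).Adelic → ℕ → ℂ → ℂ}
    (hF : ∀ g (n : ℕ), n₀ ≤ n → MeromorphicOn (F g n) (Metric.ball (0 : ℂ) (n + 2)))
    (hFE : ∀ g (n : ℕ), n₀ ≤ n → ∀ z ∈ Metric.ball (0 : ℂ) (n + 2), 1 < z.re → F g n z = eisensteinSeriesU (flatSectionU φ z) g)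
    (hFord : ∀ g (n : ℕ), n₀ ≤ n → ∀ z ∈ Metric.ball (0 : ℂ) (n + 2), z ∈ U n → 0 ≤ meromorphicOrderAt (F g n) z)
    (hgerm : ∀ g (n : ℕ), n₀ ≤ n → ∀ j, ∀ z ∈ U n, (∫ x, h n j x * (((borelHeight x : ℝ≥0) : ℝ) : ℂ) ^ z ∂νG) ≠ 0 →
      F g n =ᶠ[𝓝[≠] z] fun s => (∫ x, h n j x * (((borelHeight x : ℝ≥0) : ℝ) : ℂ) ^ s ∂νG)⁻¹ * ∫ y, h n j y * ((vX n s : HX (↥(maximalRealSubfield L)) L (IsCMField.complexConj L) 2 (k n) μ) : (quasiSplit (↥(maximalRealSubfield L)) L (IsCMField.complexConj L) 2).automorphicQuotient → ℂ) ((quasiSplit (↥(maximalRealSubfield L)) L (IsCMField.complexConj L) 2).toAutomorphicQuotient (g * y)⁻¹) ∂νG)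
    -- the coefficient pieces (scalar families, ★ row 13's clauses; §1 produces them from X1_χ ED. 2)
    {J : Type*} {q : J → ℂ → ℂ} (hq : ∀ j, DifferentiableOn ℂ (q j) {z : ℂ | 1 < z.re})
    {Fq : J → ℕ → ℂ → ℂ}
    (hFq : ∀ j (n : ℕ), n₀ ≤ n → MeromorphicOn (Fq j n) (Metric.ball (0 : ℂ) (n + 2)))
    (hFqq : ∀ j (n : ℕ), n₀ ≤ n → ∀ z ∈ Metric.ball (0 : ℂ) (n + 2), 1 < z.re → Fq j n z = q j z)
    (hFqord : ∀ j (n : ℕ), n₀ ≤ n → ∀ z ∈ Metric.ball (0 : ℂ) (n + 2), z ∈ U n → 0 ≤ meromorphicOrderAt (Fq j n) z) :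
    ∃ (Ec : ℂ → (quasiSplit (↥(maximalRealSubfield L)) L (IsCMField.complexConj L) 2).Adelic → ℂ) (qc : J → ℂ → ℂ) (P : Set ℂ),
      (∀ g, MeromorphicNFOn (fun z => Ec z g) univ) ∧ (∀ j, MeromorphicNFOn (qc j) univ) ∧
      (∀ z : ℂ, 1 < z.re → Ec z = eisensteinSeriesU (flatSectionU φ z)) ∧ (∀ j (z : ℂ), 1 < z.re → qc j z = q j z) ∧
      (∀ g (n : ℕ), n₀ ≤ n → ∀ z ∈ Metric.ball (0 : ℂ) (n + 2), (fun z => Ec z g) =ᶠ[𝓝[≠] z] F g n) ∧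
      (∀ j (n : ℕ), n₀ ≤ n → ∀ z ∈ Metric.ball (0 : ℂ) (n + 2), qc j =ᶠ[𝓝[≠] z] Fq j n) ∧
      IsClosed P ∧ (∀ z₀ : ℂ, ∀ᶠ s in 𝓝[≠] z₀, s ∉ P) ∧ (∀ z ∈ P, z.re ≤ 1) ∧
      (∀ z : ℂ, z ∉ P → 1 < z.re ∨ (z ∈ U (max n₀ ⌈‖z‖⌉₊) ∧ z ∈ U (max n₀ (⌈‖z‖⌉₊ + 1)))) ∧
      (∀ g (z : ℂ), z ∉ P → AnalyticAt ℂ (fun z => Ec z g) z) ∧ (∀ j (z : ℂ), z ∉ P → AnalyticAt ℂ (qc j) z) ∧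
      (∀ g, DifferentiableOn ℂ (fun z => Ec z g) Pᶜ) ∧ (∀ j, DifferentiableOn ℂ (qc j) Pᶜ) ∧
      -- (E5) THE POINTWISE REPRESENTATION on `U n ∖ P`
      (∀ g (n : ℕ), n₀ ≤ n → ∀ j, ∀ z ∈ U n, z ∉ P → (∫ x, h n j x * (((borelHeight x : ℝ≥0) : ℝ) : ℂ) ^ z ∂νG) ≠ 0 →
        Ec z g = (∫ x, h n j x * (((borelHeight x : ℝ≥0) : ℝ) : ℂ) ^ z ∂νG)⁻¹ * ∫ y, h n j y * ((vX n z : HX (↥(maximalRealSubfield L)) L (IsCMField.complexConj L) 2 (k n) μ) : (quasiSplit (↥(maximalRealSubfield L)) L (IsCMField.complexConj L) 2).automorphicQuotient → ℂ) ((quasiSplit (↥(maximalRealSubfield L)) L (IsCMField.complexConj L) 2).toAutomorphicQuotient (g * y)⁻¹) ∂νG) ∧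
      -- (E4) continuity in `g` off `P`
      ∀ z : ℂ, z ∉ P → Continuous (Ec z) := by
  haveI : νG.IsMulRightInvariant := by rw [← Measure.inv_eq_self νG]; infer_instance
  -- ★ row 13: the scalar gluing with ONE common pole set
  obtain ⟨Ec, qc, P, hEcNF, hqcNF, hEcE, hqcq, hEcF, hqcF, hPc, hPcd, hPre, hPU, hEan, hqan, hEdiff, hqdiff⟩ :=
    chiEisenstein_meromorphic_globalPoleSet_of_balls L hφM n₀ hq hUcd hF hFE hFord hFq hFqq hFqord
  -- ── (E5) NF-germ equality AT `z ∈ U n ∖ P` with `ĥ_{n,j}(z) ≠ 0` (both sides continuous at `z`, limits along `𝓝[≠] z`) ──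
  have hE5 : ∀ g (n : ℕ), n₀ ≤ n → ∀ j, ∀ z ∈ U n, z ∉ P → (∫ x, h n j x * (((borelHeight x : ℝ≥0) : ℝ) : ℂ) ^ z ∂νG) ≠ 0 →
      Ec z g = (∫ x, h n j x * (((borelHeight x : ℝ≥0) : ℝ) : ℂ) ^ z ∂νG)⁻¹ * ∫ y, h n j y * ((vX n z : HX (↥(maximalRealSubfield L)) L (IsCMField.complexConj L) 2 (k n) μ) : (quasiSplit (↥(maximalRealSubfield L)) L (IsCMField.complexConj L) 2).automorphicQuotient → ℂ) ((quasiSplit (↥(maximalRealSubfield L)) L (IsCMField.complexConj L) 2).toAutomorphicQuotient (g * y)⁻¹) ∂νG := by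
    intro g n hn j z hzU hzP hne
    have hzb : z ∈ Metric.ball (0 : ℂ) (n + 2) := hUD n hn hzU
    -- the evaluation functional of `(Re h_j, g)` (★ P3-D) and its values on the family in integral form (canonical lift, ★ `quotFun_lift`)
    obtain ⟨Λ, hΛ⟩ := exists_evalCLM μ νG (k n) (h := fun x => (h n j x).re) (Complex.continuous_re.comp (hhc n j)) ((hhs n j).comp_left Complex.zero_re) g
    have hre : ∀ x, ((((h n j x).re : ℝ)) : ℂ) = h n j x := fun x => Complex.conj_eq_iff_re.1 (hreal n j x)
    have hΛv : ∀ s, Λ (vX n s) = ∫ y, h n j y * ((vX n s : HX (↥(maximalRealSubfield L)) L (IsCMField.complexConj L) 2 (k n) μ) : (quasiSplit (↥(maximalRealSubfield L)) L (IsCMField.complexConj L) 2).automorphicQuotient → ℂ) ((quasiSplit (↥(maximalRealSubfield L)) L (IsCMField.complexConj L) 2).toAutomorphicQuotient (g * y)⁻¹) ∂νG := by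
      intro s
      have hmem : MemLp ((quasiSplit (↥(maximalRealSubfield L)) L (IsCMField.complexConj L) 2).quotFun (fun y : (quasiSplit (↥(maximalRealSubfield L)) L (IsCMField.complexConj L) 2).Adelic => ((vX n s : HX (↥(maximalRealSubfield L)) L (IsCMField.complexConj L) 2 (k n) μ) : (quasiSplit (↥(maximalRealSubfield L)) L (IsCMField.complexConj L) 2).automorphicQuotient → ℂ) ((quasiSplit (↥(maximalRealSubfield L)) L (IsCMField.complexConj L) 2).toAutomorphicQuotient y⁻¹))) 2
          (μ.withDensity fun x => (((supHeight (↥(maximalRealSubfield L)) L (IsCMField.complexConj L) 2 x)⁻¹ ^ (2 * k n) : ℝ≥0) : ℝ≥0∞)) := by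
        rw [quotFun_lift]; exact Lp.memLp (vX n s)
      have htoHX : toHX (↥(maximalRealSubfield L)) L (IsCMField.complexConj L) 2 (k n) μ (fun y : (quasiSplit (↥(maximalRealSubfield L)) L (IsCMField.complexConj L) 2).Adelic => ((vX n s : HX (↥(maximalRealSubfield L)) L (IsCMField.complexConj L) 2 (k n) μ) : (quasiSplit (↥(maximalRealSubfield L)) L (IsCMField.complexConj L) 2).automorphicQuotient → ℂ) ((quasiSplit (↥(maximalRealSubfield L)) L (IsCMField.complexConj L) 2).toAutomorphicQuotient y⁻¹)) hmem = vX n s := by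
        have key : ∀ (f : (quasiSplit (↥(maximalRealSubfield L)) L (IsCMField.complexConj L) 2).automorphicQuotient → ℂ) (hf : MemLp f 2 (μ.withDensity fun x => (((supHeight (↥(maximalRealSubfield L)) L (IsCMField.complexConj L) 2 x)⁻¹ ^ (2 * k n) : ℝ≥0) : ℝ≥0∞))),
            f = ((vX n s : HX (↥(maximalRealSubfield L)) L (IsCMField.complexConj L) 2 (k n) μ) : (quasiSplit (↥(maximalRealSubfield L)) L (IsCMField.complexConj L) 2).automorphicQuotient → ℂ) → hf.toLp f = vX n s := by
          rintro f hf rfl; exact Lp.toLp_coeFn _ _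
        exact key _ hmem (quotFun_lift _)
      have e := (hΛ (fun y : (quasiSplit (↥(maximalRealSubfield L)) L (IsCMField.complexConj L) 2).Adelic => ((vX n s : HX (↥(maximalRealSubfield L)) L (IsCMField.complexConj L) 2 (k n) μ) : (quasiSplit (↥(maximalRealSubfield L)) L (IsCMField.complexConj L) 2).automorphicQuotient → ℂ) ((quasiSplit (↥(maximalRealSubfield L)) L (IsCMField.complexConj L) 2).toAutomorphicQuotient y⁻¹)) (lift_quotientSubgroup_mul _) hmem).2
      rw [htoHX] at e
      rw [e]; simp only [hre]
    have hev : (fun z => Ec z g) =ᶠ[𝓝[≠] z] fun s => (∫ x, h n j x * (((borelHeight x : ℝ≥0) : ℝ) : ℂ) ^ s ∂νG)⁻¹ * Λ (vX n s) :=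
      (hEcF g n hn z hzb).trans ((hgerm g n hn j z hzU hne).trans (Eventually.of_forall fun s => by simp only [hΛv]))
    have hĥc : Continuous fun s : ℂ => (∫ x, h n j x * (((borelHeight x : ℝ≥0) : ℝ) : ℂ) ^ s ∂νG) := (differentiable_integral_mul_borelHeight_cpow νG (hhc n j) (hhs n j)).continuous
    have hRc : ContinuousAt (fun s => (∫ x, h n j x * (((borelHeight x : ℝ≥0) : ℝ) : ℂ) ^ s ∂νG)⁻¹ * Λ (vX n s)) z :=
      (hĥc.continuousAt.inv₀ hne).mul (Λ.continuous.continuousAt.comp ((hvXd n hn).continuousOn.continuousAt ((hUo n hn).mem_nhds hzU)))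
    have huniq := tendsto_nhds_unique ((hEan g z hzP).continuousAt.continuousWithinAt.tendsto.congr' hev) hRc.continuousWithinAt.tendsto
    rw [huniq, hΛv]
  -- ── (E4) continuity in `g` off `P`: on `{1 < Re}` it is `E(f_z^φ)` (★ regularity for bounded continuous `φ`); elsewhere (E5) at the ball `max n₀ ⌈‖z‖⌉₊` + ★ X2a `continuous_integral_mul_lift` ──
  have hball : ∀ z : ℂ, z ∈ Metric.ball (0 : ℂ) (((max n₀ ⌈‖z‖⌉₊ : ℕ) : ℝ) + 2) := fun z => by
    rw [Metric.mem_ball, dist_zero_right]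
    have h1 : ‖z‖ ≤ (⌈‖z‖⌉₊ : ℝ) := Nat.le_ceil ‖z‖
    have h2 : ((⌈‖z‖⌉₊ : ℕ) : ℝ) ≤ ((max n₀ ⌈‖z‖⌉₊ : ℕ) : ℝ) := by exact_mod_cast le_max_right n₀ ⌈‖z‖⌉₊
    linarith
  have hE4 : ∀ z : ℂ, z ∉ P → Continuous (Ec z) := by
    intro z hzP
    rcases hPU z hzP with hz1 | ⟨hzU, -⟩
    · rw [hEcE z hz1]; exact continuous_eisensteinSeriesU_flatSectionU_cm_two L hz1 hφc hφM
    · obtain ⟨j, hj⟩ := hcov (max n₀ ⌈‖z‖⌉₊) (le_max_left _ _) z (hball z)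
      rw [show Ec z = fun g => Ec z g from rfl, show (fun g => Ec z g) = _ from funext fun g => hE5 g (max n₀ ⌈‖z‖⌉₊) (le_max_left _ _) j z hzU hzP hj]
      exact continuous_const.mul (continuous_integral_mul_lift μ νG (k (max n₀ ⌈‖z‖⌉₊)) (Lp.memLp (vX (max n₀ ⌈‖z‖⌉₊) z)) (hhc _ j) (hhs _ j))
  exact ⟨Ec, qc, P, hEcNF, hqcNF, hEcE, hqcq, hEcF, hqcF, hPc, hPcd, hPre, hPU, hEan, hqan, hEdiff, hqdiff, hE5, hE4⟩

end CM

end Summit.HodgeConjecture.HodgeConjecture.Cruxes.H413.K2E1ChiEisensteinMeromorphicExportsU2Global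

end
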